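import Summits.BirchSwinnertonDyer.BirchSwinnertonDyer.Theorems.ThetaPartnerAtTwoSignedTransportAtTwoLocalEmbedding
import Literature.NumberTheory.EllipticCurves.SelmerCorankProofs
import HarnessLib

/-!
# `#(Sel♯_{S₀}/Sel♯_∅)[p] = p^{Σ_{v∈S₀} N_v·d_v}` from SURJECTIVITY onto the local factors and the LOCAL counts — the assembly of
# GV 2000 Cor. (2.3) (`S^{Σ₀}/S ≅ ⊕_{v∈Σ₀} 𝓗_v(ℚ_∞)`) for the imprimitive SIGNED Selmer groups, splitting the registered stub `stub_locCard2` of line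
# `bridge` v20 into a global half (Prop. (2.1), research at `p = 2`) and a local half (Prop. (2.4), in print) (crux `SignedTransportAtTwo`,
# stmt-BirchSwinnertonDyer-20333, route `ThetaPartnerAtTwo`) (lead prover bsd-wall-tp2-p1 g6; `--supports`; route-independent, closes nothing)

HONEST FRAMING. THEOREMS ONLY; no definition (the local factor `Y_v ⊆ H¹(H ∩ I_v, E[p^∞])` is SPELLED OUT as the range of the restriction from
`H¹(H ∩ D_v, E[p^∞])`, i.e. GV's `𝓗_η = H¹((K_∞)_η, A) → H¹(I_η, A)` at the chosen place; the imprimitive signed Selmer groups `Sel♯_S` as in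
p583281). BSD is not proved by any of this; NEITHER the surjectivity (`hsurj`, GV Prop. (2.1)) NOR the local counts (`hloc`, GV Prop. (2.4)) is
proved here — they are the hypotheses.

* `resH1Hom_inertiaInToH_eq_comp` — the restriction `r_v : H¹(H, A) → H¹(H ∩ I_v, A)` factors through `H¹(H ∩ D_v, A)`, so `r_v(conj_{γⁿ} c) ∈ Y_v`;
* `natCard_torsionBy_sharp_quotient_eq_of_surj_of_loc` — for any number field, prime, `ℤ_p`-extension with topological generator `γ`, sign,
  finite `S₀ ∌ (v ∣ p)`, representative numbers `N_v` (`Γ_K = H·D_v·{γⁿ : n < N_v}`): if the detecting map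
  `(r_v ∘ conj_{γⁿ})_{v∈S₀,n<N_v} : Sel♯_{S₀} → ∏_v ∏_{n<N_v} Y_v` is ONTO and `#Y_v[p] = p^{d_v}`, then `#(Sel♯_{S₀}/Sel♯_∅)[p] = p^{Σ_v N_v d_v}`
  (kernel `= Sel♯_∅` as in p583281; `p`-torsion of a finite product).

References: [GreenbergVatsal2000] §2 Prop. (2.1), Cor. (2.3), Prop. (2.4) (pp. 17–22); [Matsuno2008] Prop. 2.2, Cor. 2.3, Lemma 2.4; [Kobayashi2003] Def. 1.1.
-/

set_option autoImplicit false
-- D-0017: single-problem summit, so `Summit.BirchSwinnertonDyer.BirchSwinnertonDyer.…` repeats a namespace BY DESIGN.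
set_option linter.dupNamespace false

noncomputable section

open scoped Classical AddSubgroup

open NumberField IsDedekindDomain Field CategoryTheory
open Literature.NumberTheory.GaloisRepresentations Literature.NumberTheory.EllipticCurves
  Literature.NumberTheory.EllipticCurves.GreenbergSelmer
  Literature.NumberTheory.EllipticCurves.GreenbergVatsal2000
  Literature.NumberTheory.EllipticCurves.Kobayashi2003
  Summit.BirchSwinnertonDyer.Rank1Residual.Iwasawa

namespace Summit.BirchSwinnertonDyer.BirchSwinnertonDyer.Theorems.SignedTransportAtTwo

universe u

section General

variable {K : Type u} [Field K] [NumberField K] (W : WeierstrassCurve K)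
  {p : ℕ} [hp : Fact p.Prime] (κ : ZpExtension K p) {γ : absoluteGaloisGroup K}

omit hp in
/-- **`r_v = res_{I/D} ∘ res_{D/H}`**: the restriction `H¹(H, E[p^∞]) → H¹(H ∩ I_v, E[p^∞])` factors through `H¹(H ∩ D_v, E[p^∞])`
(`inertiaInToH = decompInToH ∘ incl`, functoriality `resH1Hom_comp`). GV p. 17 (`H¹((ℚ_∞)_η, A) → H¹(I_η, A)`). [cite: GreenbergVatsal2000, §2 p. 17] -/
theorem resH1Hom_inertiaInToH_eq_comp (H : Subgroup (absoluteGaloisGroup K)) (v : HeightOneSpectrum (𝓞 K))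
    (c : subgroupH1 H (W.geomPrimaryTorsion p)) :
    resH1Hom (inertiaInToH H v) (AddMonoidHom.id (W.geomPrimaryTorsion p)) (fun _ _ ↦ rfl) c =
      resH1Hom (subgroupInclusion (inertiaIn_le_decompIn H v)) (AddMonoidHom.id (W.geomPrimaryTorsion p)) (fun _ _ ↦ rfl)
        (resH1Hom (decompInToH H v) (AddMonoidHom.id (W.geomPrimaryTorsion p)) (fun _ _ ↦ rfl) c) := by
  have h := congrArg (fun f ↦ f c) (resH1Hom_comp (decompInToH H v) (AddMonoidHom.id (W.geomPrimaryTorsion p)) (fun _ _ ↦ rfl)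
    (subgroupInclusion (inertiaIn_le_decompIn H v)) (AddMonoidHom.id (W.geomPrimaryTorsion p)) (fun _ _ ↦ rfl))
  simp only [AddMonoidHom.coe_comp, Function.comp_apply] at h
  rw [h]
  exact DFunLike.congr_fun (resH1Hom_congr rfl (AddMonoidHom.ext fun _ ↦ rfl) _ _) c

/-- **`#(Sel♯_{S₀}/Sel♯_∅)[p] = p^{Σ_{v∈S₀} N_v·d_v}` from surjectivity and local counts** (GV Cor. (2.3) assembled: the detecting map
`(r_v ∘ conj_{γⁿ})_{v,n}` has kernel `Sel♯_∅` on `Sel♯_{S₀}` and lands in `∏_v ∏_{n<N_v} Y_v`, `Y_v = im(H¹(H ∩ D_v, A) → H¹(H ∩ I_v, A))`; if it is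
ONTO (`hsurj`, GV Prop. (2.1)) and `#Y_v[p] = p^{d_v}` (`hloc`, GV Prop. (2.4)), count the `p`-torsion of the product).
[cite: GreenbergVatsal2000, §2 Cor. (2.3), Prop. (2.1), Prop. (2.4)] [cite: Kobayashi2003, Def. 1.1] -/
theorem natCard_torsionBy_sharp_quotient_eq_of_surj_of_loc (ε : ℤˣ)
    (S₀ : Finset (HeightOneSpectrum (𝓞 K))) (hS₀ : ∀ v ∈ S₀, ((p : ℕ) : 𝓞 K) ∉ v.asIdeal)
    (N d : HeightOneSpectrum (𝓞 K) → ℕ)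
    (hrep : ∀ v ∈ S₀, ∀ σ : absoluteGaloisGroup K, ∃ n < N v, ∃ δ ∈ decomp (K := K) v,
      ∃ h ∈ κ.kerSubgroup, σ = h * (δ * γ ^ n))
    (hsurj : ∀ y : (Π i : ↥S₀, Fin (N i.1) → discreteH1 (inertiaIn κ.kerSubgroup i.1) (W.geomPrimaryTorsion p)),
      (∀ (i : ↥S₀) (n : Fin (N i.1)), y i n ∈
        (resH1Hom (subgroupInclusion (inertiaIn_le_decompIn κ.kerSubgroup i.1)) (AddMonoidHom.id (W.geomPrimaryTorsion p))
          (fun _ _ ↦ rfl)).range) →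
      ∃ c ∈ unramifiedOutside κ.kerSubgroup ↥(W.geomPrimaryTorsion p) p (↑S₀ : Set (HeightOneSpectrum (𝓞 K))) ⊓
          ⨅ (v : HeightOneSpectrum (𝓞 K)) (_ : ((p : ℕ) : 𝓞 K) ∈ v.asIdeal) (σ : absoluteGaloisGroup K),
            (localKummerOverOfEmb W p κ.kerSubgroup (closureEmb (K := K) (v.adicCompletion K))
                (⨆ n : ℕ, signedLocalPoints κ (v.adicCompletion K) W ε n)).comap (W.conjH1 p κ.kerSubgroup σ),
        ∀ (i : ↥S₀) (n : Fin (N i.1)),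
          resH1Hom (inertiaInToH κ.kerSubgroup i.1) (AddMonoidHom.id (W.geomPrimaryTorsion p)) (fun _ _ ↦ rfl)
            (conjH1 κ.kerSubgroup (W.geomPrimaryTorsion p) (γ ^ (n : ℕ)) c) = y i n)
    (hloc : ∀ v ∈ S₀, Nat.card ((↥((resH1Hom (subgroupInclusion (inertiaIn_le_decompIn κ.kerSubgroup v))
        (AddMonoidHom.id (W.geomPrimaryTorsion p)) (fun _ _ ↦ rfl)).range))[(p : ℤ)]) = p ^ d v) :
    Nat.card ((↥(unramifiedOutside κ.kerSubgroup ↥(W.geomPrimaryTorsion p) p (↑S₀ : Set (HeightOneSpectrum (𝓞 K))) ⊓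
          ⨅ (v : HeightOneSpectrum (𝓞 K)) (_ : ((p : ℕ) : 𝓞 K) ∈ v.asIdeal) (σ : absoluteGaloisGroup K),
            (localKummerOverOfEmb W p κ.kerSubgroup (closureEmb (K := K) (v.adicCompletion K))
                (⨆ n : ℕ, signedLocalPoints κ (v.adicCompletion K) W ε n)).comap (W.conjH1 p κ.kerSubgroup σ)) ⧸
      (unramifiedOutside κ.kerSubgroup ↥(W.geomPrimaryTorsion p) p (∅ : Set (HeightOneSpectrum (𝓞 K))) ⊓
          ⨅ (v : HeightOneSpectrum (𝓞 K)) (_ : ((p : ℕ) : 𝓞 K) ∈ v.asIdeal) (σ : absoluteGaloisGroup K),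
            (localKummerOverOfEmb W p κ.kerSubgroup (closureEmb (K := K) (v.adicCompletion K))
                (⨆ n : ℕ, signedLocalPoints κ (v.adicCompletion K) W ε n)).comap (W.conjH1 p κ.kerSubgroup σ)).addSubgroupOf
        (unramifiedOutside κ.kerSubgroup ↥(W.geomPrimaryTorsion p) p (↑S₀ : Set (HeightOneSpectrum (𝓞 K))) ⊓
          ⨅ (v : HeightOneSpectrum (𝓞 K)) (_ : ((p : ℕ) : 𝓞 K) ∈ v.asIdeal) (σ : absoluteGaloisGroup K),
            (localKummerOverOfEmb W p κ.kerSubgroup (closureEmb (K := K) (v.adicCompletion K))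
                (⨆ n : ℕ, signedLocalPoints κ (v.adicCompletion K) W ε n)).comap (W.conjH1 p κ.kerSubgroup σ)))[(p : ℤ)]) =
      p ^ (∑ v ∈ S₀, N v * d v) := by
  haveI : κ.kerSubgroup.Normal := by rw [ZpExtension.kerSubgroup]; infer_instance
  set H := κ.kerSubgroup with hH
  set A := W.geomPrimaryTorsion p with hA
  set SS := (unramifiedOutside κ.kerSubgroup ↥(W.geomPrimaryTorsion p) p (↑S₀ : Set (HeightOneSpectrum (𝓞 K))) ⊓
    ⨅ (v : HeightOneSpectrum (𝓞 K)) (_ : ((p : ℕ) : 𝓞 K) ∈ v.asIdeal) (σ : absoluteGaloisGroup K),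
      (localKummerOverOfEmb W p κ.kerSubgroup (closureEmb (K := K) (v.adicCompletion K))
          (⨆ n : ℕ, signedLocalPoints κ (v.adicCompletion K) W ε n)).comap (W.conjH1 p κ.kerSubgroup σ)) with hSS
  set S := (unramifiedOutside κ.kerSubgroup ↥(W.geomPrimaryTorsion p) p (∅ : Set (HeightOneSpectrum (𝓞 K))) ⊓
    ⨅ (v : HeightOneSpectrum (𝓞 K)) (_ : ((p : ℕ) : 𝓞 K) ∈ v.asIdeal) (σ : absoluteGaloisGroup K),
      (localKummerOverOfEmb W p κ.kerSubgroup (closureEmb (K := K) (v.adicCompletion K))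
          (⨆ n : ℕ, signedLocalPoints κ (v.adicCompletion K) W ε n)).comap (W.conjH1 p κ.kerSubgroup σ)) with hS
  let ι := ↥S₀
  -- the local factors
  let Y : ∀ i : ι, AddSubgroup (discreteH1 (inertiaIn H i.1) A) := fun i ↦
    (resH1Hom (subgroupInclusion (inertiaIn_le_decompIn H i.1)) (AddMonoidHom.id A) (fun _ _ ↦ rfl)).range
  -- the detecting map
  let Φ : W.subgroupH1 p H →+ (Π i : ι, Fin (N i.1) → discreteH1 (inertiaIn H i.1) A) :=
    AddMonoidHom.pi fun i ↦ AddMonoidHom.pi fun n ↦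
      (resH1Hom (inertiaInToH H i.1) (AddMonoidHom.id A) fun _ _ ↦ rfl).comp
        (conjH1 H A (γ ^ (n : ℕ)))
  have hΦ : ∀ (x : W.subgroupH1 p H) (i : ι) (n : Fin (N i.1)),
      Φ x i n = resH1Hom (inertiaInToH H i.1) (AddMonoidHom.id A) (fun _ _ ↦ rfl)
        (conjH1 H A (γ ^ (n : ℕ)) x) := fun _ _ _ ↦ rfl
  -- it lands in `∏ Y`
  have hland : ∀ (x : W.subgroupH1 p H) (i : ι) (n : Fin (N i.1)), Φ x i n ∈ Y i := by
    intro x i n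
    rw [hΦ, resH1Hom_inertiaInToH_eq_comp W H i.1]
    exact ⟨_, rfl⟩
  -- the corestricted map `ψ : SS → B := ∏_i ∏_n Y i`
  let ψ : SS →+ (∀ i : ι, Fin (N i.1) → Y i) :=
    { toFun := fun s ↦ fun i n ↦ ⟨Φ (s : W.subgroupH1 p H) i n, hland _ i n⟩
      map_zero' := by funext i n; exact Subtype.ext (by simp [map_zero])
      map_add' := fun s t ↦ by funext i n; exact Subtype.ext (by simp [map_add]) }
  have hψ : ∀ (s : SS) (i : ι) (n : Fin (N i.1)), ((ψ s i n : Y i) : discreteH1 (inertiaIn H i.1) A) =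
      Φ (s : W.subgroupH1 p H) i n := fun _ _ _ ↦ rfl
  -- (a) the kernel of `ψ` is `S`
  have hker : ∀ s : SS, ψ s = 0 ↔ (s : W.subgroupH1 p H) ∈ S := by
    intro s
    constructor
    · intro h0
      rw [hS, mem_sharp_empty_iff W κ ε (↑S₀ : Set _)]
      refine ⟨s.2, fun v hv hpv σ ↦ ?_⟩
      refine forall_conjH1_mem_unramifiedKer_of_forall_lt κ A
        (hrep v (Finset.mem_coe.1 hv)) (fun n hn ↦ ?_) σ
      have h := congrArg (fun y : Y ⟨v, Finset.mem_coe.1 hv⟩ ↦ (y : discreteH1 (inertiaIn H v) A))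
        (congrFun (congrFun h0 ⟨v, Finset.mem_coe.1 hv⟩) ⟨n, hn⟩)
      simp only at h
      rw [hψ, hΦ] at h
      exact h
    · intro hs
      funext i n
      apply Subtype.ext
      rw [hψ, hΦ]
      exact ((mem_sharp_empty_iff W κ ε (↑S₀ : Set _) _).1 hs).2 i.1
        (Finset.mem_coe.2 i.2) (hS₀ i.1 i.2) (γ ^ (n : ℕ))
  have hkerEq : ψ.ker = S.addSubgroupOf SS := by
    ext s
    rw [AddMonoidHom.mem_ker, AddSubgroup.mem_addSubgroupOf]
    exact hker s
  -- (b) `ψ` is onto (hypothesis `hsurj`)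
  have hψsurj : Function.Surjective ψ := by
    intro y
    obtain ⟨c, hc, hcy⟩ := hsurj (fun i n ↦ ((y i n : Y i) : discreteH1 (inertiaIn H i.1) A)) (fun i n ↦ (y i n).2)
    refine ⟨⟨c, hc⟩, ?_⟩
    funext i n
    exact Subtype.ext (by rw [hψ, hΦ]; exact hcy i n)
  -- (c) `SS/S ≃ ∏ Y`
  let e : (↥SS ⧸ S.addSubgroupOf SS) ≃+ (∀ i : ι, Fin (N i.1) → Y i) :=
    (QuotientAddGroup.quotientAddEquivOfEq hkerEq).symm.trans (QuotientAddGroup.quotientKerEquivOfSurjective ψ hψsurj)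
  rw [Nat.card_congr (torsionByEquiv e p).toEquiv]
  -- (d) `p`-torsion of the product
  let t : ((∀ i : ι, Fin (N i.1) → Y i)[(p : ℤ)]) ≃ (∀ i : ι, Fin (N i.1) → (↥(Y i))[(p : ℤ)]) :=
    { toFun := fun x ↦ fun i n ↦ ⟨x.1 i n, by
        have h := AddSubgroup.torsionBy.nsmul_iff.1 x.2
        exact AddSubgroup.torsionBy.nsmul_iff.2 (by
          have := congrFun (congrFun h i) n
          simpa only [Pi.smul_apply, Pi.zero_apply] using this)⟩
      invFun := fun y ↦ ⟨fun i n ↦ (y i n : Y i), AddSubgroup.torsionBy.nsmul_iff.2 (by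
        funext i n
        simp only [Pi.smul_apply, Pi.zero_apply]
        exact AddSubgroup.torsionBy.nsmul_iff.1 (y i n).2)⟩
      left_inv := fun x ↦ Subtype.ext rfl
      right_inv := fun y ↦ by funext i n; rfl }
  rw [Nat.card_congr t, Nat.card_pi]
  have hfac : ∀ i : ι, Nat.card (Fin (N i.1) → (↥(Y i))[(p : ℤ)]) = (p ^ d i.1) ^ N i.1 := by
    intro i
    rw [Nat.card_pi, Finset.prod_const, Finset.card_univ, Fintype.card_fin, hloc i.1 i.2]
  simp_rw [hfac, ← pow_mul]
  rw [Finset.prod_pow_eq_pow_sum, ← Finset.sum_coe_sort S₀ (fun v ↦ N v * d v)]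
  congr 1
  exact Finset.sum_congr rfl fun i _ ↦ by rw [mul_comm]

end General

end Summit.BirchSwinnertonDyer.BirchSwinnertonDyer.Theorems.SignedTransportAtTwo

end
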